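import Summits.AnomalousDissipation.AnomalousDissipation.Theorems.MomentParityResolvedDissipationSmallDataIdentity
import Literature.Analysis.FunctionSpaces.TorusInverseLaplacian
import Literature.Analysis.FunctionSpaces.TorusCalculusProofs

/-!
# `MomentParity.ResolvedDissipation` (stmt-AnomalousDissipation-14284), line `enstrophy-ui-transfer`:
# the laminar corner of the hard stub, II — admissible laws near a sup-small steady state are Dirac

Supports stmt-AnomalousDissipation-14284 (helper of the line lead; nothing here closes an item).

`ae_eq_of_galerkinSteady_of_sup_le`: let `μ` be a finite law on `H` carried by level-`N` fields and
3-stationary for Galerkin NS at `(ν, f)` (`ν > 0`), and let `s ∈ H` be a level-`N` Galerkin steady state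
whose representative `s̄ = P_N s` satisfies `‖s̄‖_∞ ≤ πν`. Then `u = s` for `μ`-a.e. `u`: by the shifted-energy
Lyapunov identity (`…SmallDataIdentity`) the row integrand is `2(−ν‖∇w̄‖² + b(w̄,w̄,s̄))`, and
`|b(w̄,w̄,s̄)| ≤ ‖s̄‖_∞ ‖w̄‖₂ ‖∇w̄‖₂ ≤ ‖s̄‖_∞ ‖∇w̄‖₂²/(2π)` (AM–GM + Poincaré on mean-zero trigonometric
polynomials), so the integrand is `≤ −ν‖∇w̄‖² ≤ 0` with zero mean, hence `∇w̄ = 0`, `w̄ = 0`, `u = s` a.e.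
Consequence (`setLIntegral_eGradNormSq_eq_zero_of_galerkinSteady`): the enstrophy of such a law never
exceeds `‖∇s‖²`, which is the uniform-integrability statement of the hard stub in this laminar corner once a
family of such steady states with an `N`-uniform enstrophy bound is supplied (small data, next file).
-/

noncomputable section

-- `Summit.<Summit>.<Problem>`: single-conjunct summit, the duplicate namespace segment is mandated.
set_option linter.dupNamespace false

namespace Summit.AnomalousDissipation.AnomalousDissipation.Theorems.MomentParityResolvedDissipation

open MeasureTheory Filter Topology
open scoped ENNReal InnerProductSpace RealInnerProductSpace
open Literature.Analysis.FunctionSpaces Literature.Analysis.FluidPDE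
open Summit.AnomalousDissipation.AnomalousDissipation.Theses.MomentParity
open Summit.AnomalousDissipation.AnomalousDissipation.Theorems.CubicParityLoud.Negative
  (T3 R3 H3 L2T3 frameG energyPoly isBandTest_frameG)
open Summit.AnomalousDissipation.AnomalousDissipation.Theorems.QuarticGate.Negative
  (IsLevel IsBandTest polyGrad IsPolyStationary)
open Summit.AnomalousDissipation.AnomalousDissipation.Theorems.UniformResolution.Negative
  (IsGalerkinSteady coef trunc trunc_eq integrable_coe isConjSymm_coef coef_zero isBandTest_trunc
    coe_ae_eq_trunc toReal_eGradNormSq_trunc integral_sum_norm_sq_partialDeriv_realTrigPoly)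

/-! ## The difference `w̄ = ū − s̄` as a trigonometric polynomial; Poincaré; the viscous term -/

/-- `ū − s̄ = realTrigPoly (freqBall N) (coef u − coef s)`. [folklore] -/
theorem trunc_sub_eq (N : ℕ) (u s : H3) :
    trunc N u - trunc N s = Torus.realTrigPoly (Torus.freqBall N) (coef u - coef s) := by
  rw [trunc_eq, trunc_eq, Torus.realTrigPoly_sub]

/-- **Poincaré for `w̄`**: `4π² ∫‖w̄‖² ≤ ∫ Σⱼ‖∂ⱼw̄‖²` (the zero mode of `w̄` vanishes, `|k|² ≥ 1` else). [folklore] -/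
theorem poincare_trunc_sub (N : ℕ) (u s : H3) :
    4 * Real.pi ^ 2 * ∫ x, ‖(trunc N u - trunc N s) x‖ ^ 2 ≤
      ∫ x, ∑ j, ‖Torus.partialDeriv j (trunc N u - trunc N s) x‖ ^ 2 := by
  have hc : Torus.IsConjSymm (coef u - coef s) := (isConjSymm_coef u).sub (isConjSymm_coef s)
  rw [trunc_sub_eq, Torus.integral_norm_sq_realTrigPoly Torus.neg_mem_freqBall_of_mem hc,
    Summit.AnomalousDissipation.AnomalousDissipation.Theorems.UniformResolution.Negative.integral_sum_norm_sq_partialDeriv_realTrigPoly Torus.neg_mem_freqBall_of_mem hc, Finset.mul_sum, Finset.mul_sum]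
  refine Finset.sum_le_sum fun k _ => ?_
  by_cases hk : k = 0
  · subst hk
    simp [coef_zero]
  · have h1 : 1 ≤ Torus.freqNormSq k := Torus.one_le_freqNormSq_of_ne_zero hk
    have h0 : 0 ≤ ‖(coef u - coef s) k‖ ^ 2 := sq_nonneg _
    have hpi : 0 ≤ 4 * Real.pi ^ 2 := by positivity
    nlinarith [mul_le_mul_of_nonneg_left (mul_le_mul_of_nonneg_right h1 h0) hpi]

/-- **The viscous term**: `∫⟪w̄, Δw̄⟫ = −∫ Σⱼ‖∂ⱼw̄‖²`. [folklore] -/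
theorem integral_inner_laplacian_trunc_sub (N : ℕ) (u s : H3) :
    ∫ x, ⟪(trunc N u - trunc N s) x, Torus.laplacian (trunc N u - trunc N s) x⟫_ℝ =
      -∫ x, ∑ j, ‖Torus.partialDeriv j (trunc N u - trunc N s) x‖ ^ 2 := by
  have hW : Torus.IsSmooth (trunc N u - trunc N s) :=
    (Torus.isSmooth_fourierTruncate N ((u.1 : L2T3) : T3 → R3)).sub
      (Torus.isSmooth_fourierTruncate N ((s.1 : L2T3) : T3 → R3))
  rw [Torus.integral_inner_laplacian_eq_neg_holds hW, integral_finsetSum _ fun j _ =>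
    ((hW.partialDeriv j).norm_sq).integrable]

/-! ## The transport term is dominated by the viscous term when `‖s̄‖_∞ ≤ πν` -/

/-- **Transport bound**: `|∫⟪(w̄·∇)w̄, s̄⟫| ≤ A·(∫Σⱼ‖∂ⱼw̄‖²)/(2π)` whenever `‖s̄‖ ≤ A` pointwise
(pointwise `‖(w̄·∇)w̄‖ ≤ ‖w̄‖(Σ‖∂ⱼw̄‖²)^{1/2}`, AM–GM with weight `2π`, Poincaré). [folklore] -/
theorem abs_transport_le (N : ℕ) (u s : H3) {A : ℝ} (hA : ∀ x, ‖trunc N s x‖ ≤ A) :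
    |∫ x, ⟪Torus.convect (trunc N u - trunc N s) (trunc N u - trunc N s) x, trunc N s x⟫_ℝ| ≤
      A * (∫ x, ∑ j, ‖Torus.partialDeriv j (trunc N u - trunc N s) x‖ ^ 2) / (2 * Real.pi) := by
  set wb : T3 → R3 := trunc N u - trunc N s with hwb
  have hU : Torus.IsSmooth (trunc N u) := Torus.isSmooth_fourierTruncate N ((u.1 : L2T3) : T3 → R3)
  have hSm : Torus.IsSmooth (trunc N s) := Torus.isSmooth_fourierTruncate N ((s.1 : L2T3) : T3 → R3)
  have hW : Torus.IsSmooth wb := hU.sub hSm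
  have hA0 : 0 ≤ A := (norm_nonneg _).trans (hA 0)
  have hpi : 0 < Real.pi := Real.pi_pos
  -- pointwise AM–GM: `|⟪(w̄·∇)w̄, s̄⟫| ≤ A (π‖w̄‖² + Σ‖∂w̄‖²/(4π))`
  have hpt : ∀ x, ‖⟪Torus.convect wb wb x, trunc N s x⟫_ℝ‖ ≤
      A * (Real.pi * ‖wb x‖ ^ 2 + (∑ j, ‖Torus.partialDeriv j wb x‖ ^ 2) / (4 * Real.pi)) := by
    intro x
    set y : ℝ := Real.sqrt (∑ j, ‖Torus.partialDeriv j wb x‖ ^ 2) with hy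
    have hy0 : 0 ≤ y := Real.sqrt_nonneg _
    have hyy : y ^ 2 = ∑ j, ‖Torus.partialDeriv j wb x‖ ^ 2 := Real.sq_sqrt (Finset.sum_nonneg fun j _ => sq_nonneg _)
    have h1 : ‖⟪Torus.convect wb wb x, trunc N s x⟫_ℝ‖ ≤ ‖wb x‖ * y * A := by
      refine (norm_inner_le_norm _ _).trans ?_
      exact mul_le_mul (UniformResolution.Negative.norm_convect_self_le hW x) (hA x) (norm_nonneg _)
        (mul_nonneg (norm_nonneg _) hy0)
    have h2 : ‖wb x‖ * y ≤ Real.pi * ‖wb x‖ ^ 2 + y ^ 2 / (4 * Real.pi) := by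
      have key : 0 ≤ (2 * Real.pi * ‖wb x‖ - y) ^ 2 := sq_nonneg _
      rw [← sub_nonneg]
      have e : Real.pi * ‖wb x‖ ^ 2 + y ^ 2 / (4 * Real.pi) - ‖wb x‖ * y =
          (2 * Real.pi * ‖wb x‖ - y) ^ 2 / (4 * Real.pi) := by
        field_simp
        ring
      rw [e]
      positivity
    calc ‖⟪Torus.convect wb wb x, trunc N s x⟫_ℝ‖ ≤ ‖wb x‖ * y * A := h1
      _ = A * (‖wb x‖ * y) := by ring
      _ ≤ A * (Real.pi * ‖wb x‖ ^ 2 + y ^ 2 / (4 * Real.pi)) := mul_le_mul_of_nonneg_left h2 hA0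
      _ = _ := by rw [hyy]
  -- integrate
  have iW2 : Integrable (fun x => ‖wb x‖ ^ 2) volume := hW.norm_sq.integrable
  have iQ : Integrable (fun x => ∑ j, ‖Torus.partialDeriv j wb x‖ ^ 2) volume :=
    (continuous_finsetSum _ fun j _ => ((hW.partialDeriv j).continuous.norm.pow 2)).integrable_unitAddTorus
  have ibound : Integrable (fun x => A * (Real.pi * ‖wb x‖ ^ 2 +
      (∑ j, ‖Torus.partialDeriv j wb x‖ ^ 2) / (4 * Real.pi))) volume :=
    ((iW2.const_mul _).add (iQ.div_const _)).const_mul _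
  have hint := norm_integral_le_of_norm_le ibound (ae_of_all _ hpt)
  rw [Real.norm_eq_abs] at hint
  refine hint.trans ?_
  rw [integral_const_mul, integral_add (iW2.const_mul _) (iQ.div_const _), integral_const_mul,
    integral_div]
  have hP := poincare_trunc_sub N u s
  rw [← hwb] at hP
  set D : ℝ := ∫ x, ∑ j, ‖Torus.partialDeriv j wb x‖ ^ 2 with hD
  set E2 : ℝ := ∫ x, ‖wb x‖ ^ 2 with hE2
  -- `A (π E2 + D/(4π)) ≤ A D/(2π)` from `4π² E2 ≤ D`
  have hD0 : 0 ≤ D := integral_nonneg fun x => Finset.sum_nonneg fun j _ => sq_nonneg _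
  have key : Real.pi * E2 + D / (4 * Real.pi) ≤ D / (2 * Real.pi) := by
    have h4 : Real.pi * E2 ≤ D / (4 * Real.pi) := by
      rw [le_div_iff₀ (by positivity)]
      nlinarith
    have h5 : D / (4 * Real.pi) + D / (4 * Real.pi) = D / (2 * Real.pi) := by
      field_simp
      ring
    linarith
  calc A * (Real.pi * E2 + D / (4 * Real.pi)) ≤ A * (D / (2 * Real.pi)) := mul_le_mul_of_nonneg_left key hA0
    _ = A * D / (2 * Real.pi) := by ring

/-! ## Admissible laws near a sup-small steady state are Dirac -/

/-- **Admissible laws are the Dirac mass at a sup-small Galerkin steady state.** Let `ν > 0`, `f` smooth,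
and let `μ` be a law on `H` carried by level-`N` fields which is 3-stationary for Galerkin NS at `(ν, f)` and
level `N`. If `s ∈ H` is a level-`N` Galerkin steady state at `(ν, f)` with `‖s̄(x)‖ ≤ A ≤ πν` for all `x`
(`s̄ = P_N s`), then `u = s` for `μ`-a.e. `u`. Laminar corner of the hard stub of line
`enstrophy-ui-transfer`: Temam's small-data uniqueness (Temam 1979 Ch. II Thm. 1.3) in the ensemble, via the
shifted-energy row. [cite: Temam1979, Ch. II Thm. 1.3] -/
theorem ae_eq_of_galerkinSteady_of_sup_le :
    ∀ {ν : ℝ}, 0 < ν → ∀ {f : T3 → R3}, Torus.IsSmooth f → ∀ {N : ℕ} {μ : Measure H3},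
    (∀ᵐ u ∂μ, IsLevel N u) → IsPolyStationary ν f N 3 μ → ∀ {s : H3}, IsLevel N s → IsGalerkinSteady ν f N s →
    ∀ {A : ℝ}, (∀ x, ‖trunc N s x‖ ≤ A) → A ≤ Real.pi * ν → ∀ᵐ u ∂μ, u = s := by
  intro ν hν f hf N μ hL hS s hs hst A hA hAν
  have hpi : 0 < Real.pi := Real.pi_pos
  have hA0 : 0 ≤ A := (norm_nonneg _).trans (hA 0)
  -- the row integrand and its sign
  set D : H3 → ℝ := fun u => ∫ x, ∑ j, ‖Torus.partialDeriv j (trunc N u - trunc N s) x‖ ^ 2 with hD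
  set G : H3 → ℝ := fun u => Torus.nsGeneratorPairing ν f u
    (fun x => (2 : ℝ) • (trunc N u x - trunc N s x)) with hG
  have hD0 : ∀ u, 0 ≤ D u := fun u => integral_nonneg fun x => Finset.sum_nonneg fun j _ => sq_nonneg _
  have hGle : ∀ᵐ u ∂μ, G u ≤ -(ν * D u) := by
    filter_upwards [hL] with u hu
    have hid := shiftedEnergy_generator_eq ν f hf N u s hu hs hst
    have hT := abs_transport_le N u s hA
    have hlap := integral_inner_laplacian_trunc_sub N u s
    simp only [hG, hD]
    rw [nsGeneratorPairing_two_smul_sub ν hf N u s, hid]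
    have hlap' : ∫ x, ⟪trunc N u x - trunc N s x, Torus.laplacian (trunc N u - trunc N s) x⟫_ℝ =
        -∫ x, ∑ j, ‖Torus.partialDeriv j (trunc N u - trunc N s) x‖ ^ 2 := hlap
    rw [hlap']
    have hb := (le_abs_self _).trans hT
    set Dv := ∫ x, ∑ j, ‖Torus.partialDeriv j (trunc N u - trunc N s) x‖ ^ 2
    have hDv0 : 0 ≤ Dv := hD0 u
    -- `b ≤ A Dv/(2π) ≤ (ν/2) Dv`
    have h2 : A * Dv / (2 * Real.pi) ≤ ν / 2 * Dv := by
      rw [div_le_iff₀ (by positivity)]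
      nlinarith [mul_le_mul_of_nonneg_right hAν hDv0]
    nlinarith
  -- zero mean and integrability of the row
  obtain ⟨hGi, hG0⟩ := shiftedEnergy_row hS s
  -- hence `ν D = 0` a.e.
  have hnonneg : ∀ᵐ u ∂μ, 0 ≤ -G u - ν * D u := by
    filter_upwards [hGle] with u hu
    linarith
  have hle' : ∀ᵐ u ∂μ, ν * D u ≤ -G u := by
    filter_upwards [hGle] with u hu
    linarith
  have hDmeas : AEStronglyMeasurable (fun u => ν * D u) μ := by
    -- `ν D u = -(G u) - (-(G u) - ν D u)`; instead bound measurability through integrability below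
    have h1 : Integrable (fun u => -G u) μ := hGi.neg
    -- `0 ≤ ν D ≤ -G` a.e. gives integrability of `ν D` once it is a.e.-measurable; we get measurability from
    -- continuity of `u ↦ D u` on `H` (finite sums of squares of continuous coefficient maps)
    have hcont : Continuous fun u : H3 => D u := by
      have e : ∀ u : H3, D u = 4 * Real.pi ^ 2 * ∑ k ∈ Torus.freqBall N,
          Torus.freqNormSq k * ‖(coef u - coef s) k‖ ^ 2 := fun u => by
        simp only [hD]
        rw [trunc_sub_eq, Summit.AnomalousDissipation.AnomalousDissipation.Theorems.UniformResolution.Negative.integral_sum_norm_sq_partialDeriv_realTrigPoly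
          Torus.neg_mem_freqBall_of_mem ((isConjSymm_coef u).sub (isConjSymm_coef s))]
      simp_rw [e]
      refine continuous_const.mul (continuous_finsetSum _ fun k _ => continuous_const.mul ?_)
      refine ((Continuous.sub ?_ continuous_const).norm).pow 2
      exact (Torus.continuous_mFourierCoeff_complexify_coe k).comp continuous_subtype_val
    exact (continuous_const.mul hcont).aestronglyMeasurable
  have hDint : Integrable (fun u => ν * D u) μ :=
    Integrable.mono' hGi.neg hDmeas (by
      filter_upwards [hle'] with u hu
      rw [Real.norm_eq_abs, abs_of_nonneg (mul_nonneg hν.le (hD0 u))]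
      exact hu)
  have hint0 : ∫ u, ν * D u ∂μ = 0 := by
    apply le_antisymm
    · calc ∫ u, ν * D u ∂μ ≤ ∫ u, -G u ∂μ := integral_mono_ae hDint hGi.neg hle'
        _ = 0 := by rw [integral_neg, hG0, neg_zero]
    · exact integral_nonneg fun u => mul_nonneg hν.le (hD0 u)
  have hDae : ∀ᵐ u ∂μ, ν * D u = 0 :=
    (integral_eq_zero_iff_of_nonneg_ae (ae_of_all _ fun u => mul_nonneg hν.le (hD0 u)) hDint).1 hint0
  -- `D u = 0` forces `w̄ = 0`, i.e. `u = s`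
  filter_upwards [hDae, hL] with u hu hlev
  have hDu : D u = 0 := by
    rcases mul_eq_zero.1 hu with h | h
    · exact absurd h hν.ne'
    · exact h
  have hE : ∫ x, ‖(trunc N u - trunc N s) x‖ ^ 2 ≤ 0 := by
    have hP := poincare_trunc_sub N u s
    simp only [hD] at hDu
    rw [hDu] at hP
    have hpi2 : 0 < 4 * Real.pi ^ 2 := by positivity
    have hI0 : 0 ≤ ∫ x, ‖(trunc N u - trunc N s) x‖ ^ 2 := integral_nonneg fun x => sq_nonneg _
    nlinarith
  have hW : Torus.IsSmooth (trunc N u - trunc N s) :=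
    (Torus.isSmooth_fourierTruncate N ((u.1 : L2T3) : T3 → R3)).sub
      (Torus.isSmooth_fourierTruncate N ((s.1 : L2T3) : T3 → R3))
  have hw0 : trunc N u - trunc N s = 0 := Torus.eq_zero_of_integral_norm_sq_nonpos hW hE
  have htr : trunc N u = trunc N s := sub_eq_zero.1 hw0
  -- representatives agree a.e., hence the `L²` classes agree
  have hae : ((u.1 : L2T3) : T3 → R3) =ᵐ[volume] ((s.1 : L2T3) : T3 → R3) :=
    (coe_ae_eq_trunc u hlev).trans (htr ▸ (coe_ae_eq_trunc s hs).symm)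
  exact Subtype.ext (Lp.ext hae)

/-- **In the laminar corner the enstrophy of an admissible law never exceeds `‖∇s‖²`**: under the hypotheses
of `ae_eq_of_galerkinSteady_of_sup_le`, `∫_{‖∇u‖² > ‖∇s‖²} ‖∇u‖² dμ = 0`. [folklore] -/
theorem setLIntegral_eGradNormSq_eq_zero_of_galerkinSteady {ν : ℝ} (hν : 0 < ν) {f : T3 → R3}
    (hf : Torus.IsSmooth f) {N : ℕ} {μ : Measure H3} (hL : ∀ᵐ u ∂μ, IsLevel N u)
    (hS : IsPolyStationary ν f N 3 μ) {s : H3} (hs : IsLevel N s) (hst : IsGalerkinSteady ν f N s) {A : ℝ}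
    (hA : ∀ x, ‖trunc N s x‖ ≤ A) (hAν : A ≤ Real.pi * ν) {M : ℝ≥0∞}
    (hM : Torus.eGradNormSq ((s.1 : L2T3) : T3 → R3) ≤ M) :
    ∫⁻ u in {u : H3 | M < Torus.eGradNormSq ((u.1 : L2T3) : T3 → R3)},
      Torus.eGradNormSq ((u.1 : L2T3) : T3 → R3) ∂μ = 0 := by
  have hae := ae_eq_of_galerkinSteady_of_sup_le hν hf hL hS hs hst hA hAν
  have hnull : μ {u : H3 | M < Torus.eGradNormSq ((u.1 : L2T3) : T3 → R3)} = 0 := by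
    rw [measure_eq_zero_iff_ae_notMem]
    filter_upwards [hae] with u hu
    rw [hu]
    exact not_lt.2 hM
  exact setLIntegral_measure_zero _ _ hnull

end Summit.AnomalousDissipation.AnomalousDissipation.Theorems.MomentParityResolvedDissipation

end
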